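/-
Copyright (c) 2026 the pub-hodgecm-mathlib formalisation cell (harness21).  Prover seat hodgecm-mathlib-B-p10 (g25), (F11-c) LAYER B′ FILE 3 (iii) — FILE β
(the count), design pen A-p13 (g30), architect A-p06 (g26), 2026-09-01.
-/
import Literature.NumberTheory.Automorphic.UnitaryThreeAnisotropicFixedPointRegimeTwoForms  -- ★ FILE β-A (this seat): `uForm_eq_twisted`, contraction, solvability
import Literature.NumberTheory.Automorphic.UnitaryThreePHTowerRho                         -- ★ B-p04: bridge `mem_maximalIdeal_pow_iff_v_le`
import Literature.NumberTheory.LocalFields.UnramifiedQuadraticNormTwistedAntitrace         -- ★ FILE α p841926 (this seat): twisted fibres, contraction bijections, lifting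
import HarnessLib

/-!
# Flicker's Proposition 16, step (iii): in the regime `[N∕2] < m ≤ N` exactly `q^N` of the `q^{2m}` classes `q∕s mod 𝔭^m` satisfy the second fixed-point congruence
# (Flicker 1998, Prop. 16 p. 96, second row `(q+1)q^{N+2m}`)

Topic `NumberTheory/Automorphic`; namespace `Literature.NumberTheory.Automorphic.UnitaryGroup`.  THEOREMS ONLY (no `def`, no instance, no notation, no named fact, no
`sorry`); kernel lane; count-neutral.  Cell `pub/hodgecm-mathlib`, crux H413, line «N7nsCount», value stub `stub_irredGValueNeg` (κ = −1), LAYER B′ FILE 3 (iii)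
(B-p10 (g25); design pen A-p13 (g30) DESIGN v3; architect A-p06 (g26)).  HONEST LABEL: HC_CM is proved only modulo the printed citations until rung 0 closes; finite
counting for ONE regime of ONE value stub of #103-ns.

THE MATHEMATICS [Flicker1998UnitaryFL, Prop. 16 p. 96: «if `[N∕2] < m ≤ N` … `#c = q^N`»].  With ★ β-A: condition 2 at a class `u = q∕s` reads `|E_t(u)| ≤ |ϖ^{2m+1}|`,
`E_t(u) = 2ϖ^{N+1}(c − Λ(Φ_t u))`, `Λ(z) = z − Δσz` (`Δ = A_t∕σs_t`, `N(Δ) = 1`), `Φ_t` a contraction perturbation of `u ↦ 2εσu`, `c = (A_t − 1)∕(2ϖ^{N+1})` with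
`c + Δσc ∈ 𝔭^k`, `k = 2m − N`.  HEAD **`natCard_quotient_uForm_le_eq_pow`**: for `N ≤ 2m`, `m ≤ N`, `|A_t − 1| ≤ |ϖ|^{N+1}` («`N < M`»),
`Nat.card {ū : 𝒪[K] ⧸ 𝓂[K]^m // ∃ u : 𝒪[K], mk u = ū ∧ |E_t(u)| ≤ |ϖ^{2m+1}|} = q^N` — level lifting `𝔭^m → 𝔭^k` (★ α `natCard_lift_quotient_pow_eq_mul`, factor
`q^{2(m−k)}`), transport along the contraction bijection `Φ_t` of `𝒪 ⧸ 𝔭^k` (★ α `natCard_lift_comp_contraction_eq`), and the twisted Hilbert-90 count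
`#{z̄ : z̄ − Δ̄σ̄z̄ = c̄} = q^k` (★ α `natCard_twistedAntitrace_fibre_quotient_pow`): `q^{2(m−k)+k} = q^N`.  With ★ A-p13 2e-β (`(q+1)q^{2m}` norm-one classes on each
`q∕s`-fibre of `Stab(w₀) ⧸ H′_m`) this is the second row `(q+1)q^{N+2m}` of Prop. 16; the per-`m` assembly is the consumer's (B-p14 (g31) ∕ A-p13 (g30)).

## References
* [Flicker1998UnitaryFL] Y. Z. Flicker, *Elementary proof of the fundamental lemma for a unitary group*, Canad. J. Math. 50 (1998), Prop. 16 p. 96.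
* [Serre1979] J.-P. Serre, *Local Fields*, GTM 67 (1979), Ch. V §2, Ch. X §1.
-/

set_option autoImplicit false

noncomputable section

open scoped WithZero Valued

namespace Literature.NumberTheory.Automorphic

namespace UnitaryGroup

open Literature.NumberTheory.Automorphic.HermitianLattice Literature.NumberTheory.LocalFields.UnramifiedQuadraticNorm IsLocalRing

variable {K : Type*} [Field K] [Valued K ℤᵐ⁰] {ϖ : K} (σ : K →+* K)

/-! ## §3 The count: `q^N` of the `q^{2m}` classes `u ∈ 𝒪 ⧸ 𝔭^m` satisfy condition 2 (`N ≤ 2m`, `m ≤ N`, `N < M`) -/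

section Count

variable (hd : LocalConjDatum σ ϖ) (hσO : ∀ y : 𝒪[K], (σ.comp 𝒪[K].subtype) y ∈ 𝒪[K])
  [IsDiscreteValuationRing 𝒪[K]] [Finite (IsLocalRing.ResidueField 𝒪[K])]

include hd in
/-- **FLICKER'S PROPOSITION 16, SECOND ROW — the `q∕s`-count**: for `t` of type (2) read in the anisotropic frame (`N(A_t) = N(s_t)`, `N(s_t) + 4ϖN(q_t) = 1`,
`|A_t| = |s_t| = 1`, `|q_t| = |ϖ|^N`, `|A_t − s_t| ≤ |ϖ|^{N+1}`) with `N ≤ 2m`, `m ≤ N` and `|A_t − 1| ≤ |ϖ|^{N+1}` («`N < M`»), exactly **`q^N`** of the classes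
`ū ∈ 𝒪 ⧸ 𝔭^m` satisfy condition 2 `|E_t(u)| ≤ |ϖ^{2m+1}|` (the condition is constant on classes by `uForm_le_iff_of_close`).  Proof: `E_t(u) = 2ϖ^{N+1}(c − Λ(Φ_t u))`
(§1), so condition 2 ⟺ `Λ(Φ_t u) ≡ c (mod 𝔭^k)`, `k = 2m − N`; lift the count from `𝔭^m` to `𝔭^k` (★ `natCard_lift_quotient_pow_eq_mul`: factor `q^{2(m−k)}`), transport along
the contraction bijection `Φ_t` of `𝒪 ⧸ 𝔭^k` (★ `natCard_lift_comp_contraction_eq`), and count the twisted anti-trace fibre (★ `natCard_twistedAntitrace_fibre_quotient_pow`: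
`q^k`, solvable by `v_twist_le_of_regimeTwo`): `q^{2(m−k)+k} = q^N`.  Tokens: `σO = (σ.comp 𝒪[K].subtype).codRestrict 𝒪[K] hσO`, `ha₀`, `hq` as in ★ A-p13
`natCard_stabilizer_quotient_conjInt_eq` (the factor `(q+1)q^{2m}` of norm-one classes on each fibre); the per-`m` assembly `(q+1)q^{N+2m}` is the consumer's.
[cite: Flicker1998UnitaryFL, Prop. 16 p. 96] [cite: Serre1979, Ch. V §2, Ch. X §1] -/
theorem natCard_quotient_uForm_le_eq_pow {a₀ : 𝒪[K]} (ha₀ : IsUnit (((σ.comp 𝒪[K].subtype).codRestrict 𝒪[K] hσO) a₀ - a₀))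
    {q₀ : ℕ} (hq : Nat.card (IsLocalRing.ResidueField 𝒪[K]) = q₀ ^ 2)
    {At st qt : K} (hNt : σ At * At = σ st * st) (hU2t : σ st * st + 4 * ϖ * (σ qt * qt) = 1) (hAt : Valued.v At = 1) (hst1 : Valued.v st = 1)
    {N m : ℕ} (hqt : Valued.v qt = WithZero.exp (-(N : ℤ))) (hAst : Valued.v (At - st) ≤ WithZero.exp (-((N : ℤ) + 1)))
    (hA1 : Valued.v (At - 1) ≤ WithZero.exp (-((N : ℤ) + 1))) (hN2m : N ≤ 2 * m) (hmN : m ≤ N) :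
    Nat.card {x : 𝒪[K] ⧸ 𝓂[K] ^ m // ∃ u : 𝒪[K], Ideal.Quotient.mk (𝓂[K] ^ m) u = x ∧
      Valued.v ((At - 1) - 4 * ϖ * (At - st) * (((u : K) * σ u) * (1 + 4 * ϖ * ((u : K) * σ u))⁻¹) -
          4 * ϖ * ((1 + 4 * ϖ * ((u : K) * σ u))⁻¹ * (qt * σ u - At / σ st * (σ qt * u)))) ≤ Valued.v (ϖ ^ (2 * m + 1))} = q₀ ^ N := by
  classical
  -- numerology
  obtain ⟨k, hk⟩ := Nat.exists_eq_add_of_le hN2m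
  have hkN : k ≤ N := by omega
  have hkm : k ≤ m := by omega
  -- non-vanishing
  have hst : st ≠ 0 := fun h => by rw [h, map_zero] at hst1; exact zero_ne_one hst1
  have hσst : σ st ≠ 0 := fun h => hst (by rw [← hd.σσ st, h, map_zero])
  have h20 : (2 : K) ≠ 0 := fun h => by have := hd.v2; rw [h, map_zero] at this; exact zero_ne_one this
  have hϖN : ϖ ^ N ≠ 0 := pow_ne_zero _ hd.ϖ_ne_zero
  have hϖ1 : Valued.v ϖ ≤ 1 := by rw [hd.vϖ, ← WithZero.exp_zero, WithZero.exp_le_exp]; norm_num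
  -- the normalised data `ε, e, Δ, c`
  set ε : K := qt / ϖ ^ N with hεdef
  set e : K := (At - st) / ϖ ^ N with hedef
  have hε : qt = ϖ ^ N * ε := by rw [hεdef, mul_div_cancel₀ _ hϖN]
  have he : At - st = ϖ ^ N * e := by rw [hedef, mul_div_cancel₀ _ hϖN]
  obtain ⟨hvε, hve⟩ := v_eps_e_of_sizes σ hd N hε he hqt hAst
  set Δ : K := At / σ st with hΔdef
  have hvΔ : Valued.v Δ = 1 := by rw [hΔdef, map_div₀, hd.vσ, hAt, hst1, div_one]
  have hΔN : Δ * σ Δ = 1 := by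
    rw [hΔdef, map_div₀, hd.σσ, div_mul_div_comm, div_eq_one_iff_eq (mul_ne_zero hσst hst)]
    linear_combination hNt
  set c : K := (At - 1) / (2 * ϖ ^ (N + 1)) with hcdef
  have hAc : At - 1 = 2 * ϖ ^ (N + 1) * c := by rw [hcdef, mul_div_cancel₀ _ (mul_ne_zero h20 (pow_ne_zero _ hd.ϖ_ne_zero))]
  have hvc : Valued.v c ≤ 1 := by
    rw [hcdef, map_div₀, map_mul, hd.v2, one_mul, hd.v_pow, div_le_one₀ (zero_lt_iff.2 WithZero.coe_ne_zero)]
    exact hA1.trans (by rw [WithZero.exp_le_exp]; push_cast; omega)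
  have hsolv : Valued.v (c + Δ * σ c) ≤ Valued.v (ϖ ^ k) :=
    (v_twist_le_of_regimeTwo σ hd hNt hU2t hst1 N hqt hAst hA1).trans (by rw [hd.v_pow, hd.v_pow, WithZero.exp_le_exp]; omega)
  -- the ring `𝒪 = 𝒪[K]` with its involution
  set σO : 𝒪[K] →+* 𝒪[K] := (σ.comp 𝒪[K].subtype).codRestrict 𝒪[K] hσO with hσOdef
  have hσOσ : ∀ x, σO (σO x) = x := fun x => Subtype.ext (hd.σσ (x : K))
  have hσOcoe : ∀ x : 𝒪[K], ((σO x : 𝒪[K]) : K) = σ x := fun x => rfl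
  -- integral constants
  set ΔO : 𝒪[K] := ⟨Δ, hvΔ.le⟩ with hΔOdef
  set cO : 𝒪[K] := ⟨c, hvc⟩ with hcOdef
  have hv2ε : Valued.v (2 * ε) = 1 := by rw [map_mul, hd.v2, hvε, one_mul]
  set εO : 𝒪[K] := ⟨2 * ε, hv2ε.le⟩ with hεOdef
  have hεOu : IsUnit εO := (Valuation.integer.integers (Valued.v (R := K))).isUnit_iff_valuation_eq_one.2 hv2ε
  have hΔO : ΔO * σO ΔO = 1 := Subtype.ext (by push_cast [hσOcoe]; exact hΔN)
  have hcO : cO + ΔO * σO cO ∈ 𝓂[K] ^ k := by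
    rw [mem_maximalIdeal_pow_iff_v_le hd.vϖ]; push_cast [hσOcoe]; exact hsolv
  -- the contraction `Φ_t` on `𝒪`
  set ΦO : 𝒪[K] → 𝒪[K] := fun u =>
    ⟨(1 + 4 * ϖ * ((u : K) * σ u))⁻¹ * (2 * ε * σ u + e * ((u : K) * σ u)), v_phiT_le_one σ hd hvε.le (hve.trans hϖ1) u.2⟩ with hΦOdef
  have hΦOcoe : ∀ u : 𝒪[K], ((ΦO u : 𝒪[K]) : K) = (1 + 4 * ϖ * ((u : K) * σ u))⁻¹ * (2 * ε * σ u + e * ((u : K) * σ u)) := fun u => rfl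
  have hΦO : ∀ (j : ℕ) (u u' : 𝒪[K]), u - u' ∈ 𝓂[K] ^ j → ΦO u - ΦO u' - εO * (σO u - σO u') ∈ 𝓂[K] ^ (j + 1) := by
    intro j u u' h
    rw [mem_maximalIdeal_pow_iff_v_le hd.vϖ] at h ⊢
    push_cast at h
    push_cast [hΦOcoe, hσOcoe]
    refine (v_phiT_sub_phiT_sub_le σ hd hvε.le hve u.2 u'.2).trans ?_
    rw [pow_succ, map_mul, mul_comm (Valued.v (ϖ ^ j))]
    exact mul_le_mul_right h _
  -- the two predicates
  set C : 𝒪[K] → Prop := fun u =>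
    Valued.v ((At - 1) - 4 * ϖ * (At - st) * (((u : K) * σ u) * (1 + 4 * ϖ * ((u : K) * σ u))⁻¹) -
        4 * ϖ * ((1 + 4 * ϖ * ((u : K) * σ u))⁻¹ * (qt * σ u - At / σ st * (σ qt * u)))) ≤ Valued.v (ϖ ^ (2 * m + 1)) with hCdef
  set C' : 𝒪[K] → Prop := fun z => Valued.v (c - ((z : K) - Δ * σ z)) ≤ Valued.v (ϖ ^ k) with hC'def
  have hCinv : ∀ u u' : 𝒪[K], u - u' ∈ 𝓂[K] ^ k → (C u ↔ C u') := by
    intro u u' h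
    rw [mem_maximalIdeal_pow_iff_v_le hd.vϖ] at h
    exact uForm_le_iff_of_close σ hd hNt hAt hst1 N hε he hqt hAst (j := k) (by omega) u.2 u'.2 h
  have hC'inv : ∀ z z' : 𝒪[K], z - z' ∈ 𝓂[K] ^ k → (C' z ↔ C' z') := by
    intro z z' h
    rw [mem_maximalIdeal_pow_iff_v_le hd.vϖ] at h
    have hdiff : Valued.v ((c - ((z : K) - Δ * σ z)) - (c - ((z' : K) - Δ * σ z'))) ≤ Valued.v (ϖ ^ k) := by
      rw [show (c - ((z : K) - Δ * σ z)) - (c - ((z' : K) - Δ * σ z')) = -(((z : K) - Δ * σ z) - ((z' : K) - Δ * σ z')) by ring, Valuation.map_neg]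
      exact (v_twisted_sub_twisted_le σ hd hvΔ.le).trans h
    show Valued.v (c - ((z : K) - Δ * σ z)) ≤ Valued.v (ϖ ^ k) ↔ Valued.v (c - ((z' : K) - Δ * σ z')) ≤ Valued.v (ϖ ^ k)
    constructor
    · intro hz
      have e1 : c - ((z' : K) - Δ * σ z') = (c - ((z : K) - Δ * σ z)) + -((c - ((z : K) - Δ * σ z)) - (c - ((z' : K) - Δ * σ z'))) := by ring
      rw [e1]; exact Valuation.map_add_le _ hz (by rwa [Valuation.map_neg])
    · intro hz'
      have e1 : c - ((z : K) - Δ * σ z) = (c - ((z' : K) - Δ * σ z')) + ((c - ((z : K) - Δ * σ z)) - (c - ((z' : K) - Δ * σ z'))) := by ring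
      rw [e1]; exact Valuation.map_add_le _ hz' hdiff
  -- condition 2 ⟺ the twisted congruence at `Φ_t u`
  have hk1 : Valued.v (ϖ ^ (2 * m + 1)) = Valued.v (ϖ ^ k) * Valued.v (2 * ϖ ^ (N + 1)) := by
    rw [map_mul, hd.v2, one_mul, ← map_mul, ← pow_add]; congr 2; omega
  have hCC' : ∀ u : 𝒪[K], C u ↔ C' (ΦO u) := by
    intro u
    show Valued.v _ ≤ _ ↔ Valued.v (c - (((ΦO u : 𝒪[K]) : K) - Δ * σ (ΦO u))) ≤ _
    rw [uForm_eq_twisted σ hd.σσ hd.σϖ hNt hst N hε he (u : K), hΦOcoe, hAc, ← mul_sub, map_mul, hk1, mul_comm (Valued.v (2 * ϖ ^ (N + 1)))]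
    have hpos : 0 < Valued.v (2 * ϖ ^ (N + 1)) := by rw [map_mul, hd.v2, one_mul, hd.v_pow]; exact zero_lt_iff.2 WithZero.coe_ne_zero
    exact ⟨fun h => le_of_mul_le_mul_right h hpos, fun h => mul_le_mul_left h _⟩
  -- the twisted fibre, as classes
  have hpred : ∀ y : 𝒪[K] ⧸ 𝓂[K] ^ k, (∃ z : 𝒪[K], Ideal.Quotient.mk _ z = y ∧ C' z) ↔
      y - Ideal.Quotient.mk _ ΔO * Ideal.quotientMap (𝓂[K] ^ k) σO (maximalIdeal_pow_le_comap σO hσOσ k) y = Ideal.Quotient.mk _ cO := by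
    intro y
    obtain ⟨z, rfl⟩ := Ideal.Quotient.mk_surjective y
    rw [Ideal.quotientMap_mk, ← map_mul, ← map_sub, Ideal.Quotient.eq, mem_maximalIdeal_pow_iff_v_le hd.vϖ]
    push_cast [hσOcoe]
    have hneg : Valued.v ((z : K) - Δ * σ z - c) = Valued.v (c - ((z : K) - Δ * σ z)) := by
      rw [← Valuation.map_neg, neg_sub]
    rw [hneg]
    constructor
    · rintro ⟨z', hz', hC'⟩
      exact (hC'inv z' z ((Ideal.Quotient.eq).1 hz')).1 hC'
    · intro h; exact ⟨z, rfl, h⟩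
  -- assemble
  calc Nat.card {x : 𝒪[K] ⧸ 𝓂[K] ^ m // ∃ u : 𝒪[K], Ideal.Quotient.mk (𝓂[K] ^ m) u = x ∧ C u}
      = Nat.card (IsLocalRing.ResidueField 𝒪[K]) ^ (m - k) * Nat.card {y : 𝒪[K] ⧸ 𝓂[K] ^ k // ∃ u : 𝒪[K], Ideal.Quotient.mk _ u = y ∧ C u} :=
        natCard_lift_quotient_pow_eq_mul hkm C hCinv
    _ = Nat.card (IsLocalRing.ResidueField 𝒪[K]) ^ (m - k) * Nat.card {y : 𝒪[K] ⧸ 𝓂[K] ^ k // ∃ u : 𝒪[K], Ideal.Quotient.mk _ u = y ∧ C' (ΦO u)} := by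
        congr 1; exact Nat.card_congr (Equiv.subtypeEquivRight fun y => by simp only [hCC'])
    _ = Nat.card (IsLocalRing.ResidueField 𝒪[K]) ^ (m - k) * Nat.card {y : 𝒪[K] ⧸ 𝓂[K] ^ k // ∃ z : 𝒪[K], Ideal.Quotient.mk _ z = y ∧ C' z} := by
        rw [natCard_lift_comp_contraction_eq σO hσOσ ΦO hεOu hΦO k C' hC'inv]
    _ = Nat.card (IsLocalRing.ResidueField 𝒪[K]) ^ (m - k) *
          Nat.card {y : 𝒪[K] ⧸ 𝓂[K] ^ k // y - Ideal.Quotient.mk _ ΔO * Ideal.quotientMap (𝓂[K] ^ k) σO (maximalIdeal_pow_le_comap σO hσOσ k) y =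
            Ideal.Quotient.mk _ cO} := by
        congr 1; exact Nat.card_congr (Equiv.subtypeEquivRight hpred)
    _ = (q₀ ^ 2) ^ (m - k) * q₀ ^ k := by rw [hq, natCard_twistedAntitrace_fibre_quotient_pow σO hσOσ ha₀ hq hΔO k hcO]
    _ = q₀ ^ N := by rw [← pow_mul, ← pow_add]; congr 1; omega

include hd in
/-- The same count with the classes named through `toQuotPow m` (★ `UnitaryThreePHTowerRho`; the token of ★ A-p13 2e-β's fibration `z ↦ toQuotPow m (q∕s)`):
`Nat.card {x̄ : 𝒪 ⧸ 𝔭^m // ∃ u : K, |u| ≤ 1 ∧ toQuotPow m u = x̄ ∧ |E_t(u)| ≤ |ϖ^{2m+1}|} = q^N`. [cite: Flicker1998UnitaryFL, Prop. 16 p. 96] -/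
theorem natCard_toQuotPow_uForm_le_eq_pow {a₀ : 𝒪[K]} (ha₀ : IsUnit (((σ.comp 𝒪[K].subtype).codRestrict 𝒪[K] hσO) a₀ - a₀))
    {q₀ : ℕ} (hq : Nat.card (IsLocalRing.ResidueField 𝒪[K]) = q₀ ^ 2)
    {At st qt : K} (hNt : σ At * At = σ st * st) (hU2t : σ st * st + 4 * ϖ * (σ qt * qt) = 1) (hAt : Valued.v At = 1) (hst1 : Valued.v st = 1)
    {N m : ℕ} (hqt : Valued.v qt = WithZero.exp (-(N : ℤ))) (hAst : Valued.v (At - st) ≤ WithZero.exp (-((N : ℤ) + 1)))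
    (hA1 : Valued.v (At - 1) ≤ WithZero.exp (-((N : ℤ) + 1))) (hN2m : N ≤ 2 * m) (hmN : m ≤ N) :
    Nat.card {x : 𝒪[K] ⧸ 𝓂[K] ^ m // ∃ u : K, Valued.v u ≤ 1 ∧ toQuotPow m u = x ∧
      Valued.v ((At - 1) - 4 * ϖ * (At - st) * ((u * σ u) * (1 + 4 * ϖ * (u * σ u))⁻¹) -
          4 * ϖ * ((1 + 4 * ϖ * (u * σ u))⁻¹ * (qt * σ u - At / σ st * (σ qt * u)))) ≤ Valued.v (ϖ ^ (2 * m + 1))} = q₀ ^ N := by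
  rw [← natCard_quotient_uForm_le_eq_pow σ hd hσO ha₀ hq hNt hU2t hAt hst1 hqt hAst hA1 hN2m hmN]
  refine Nat.card_congr (Equiv.subtypeEquivRight fun x => ⟨?_, ?_⟩)
  · rintro ⟨u, hu, hx, hC⟩
    exact ⟨⟨u, hu⟩, by rw [← hx, toQuotPow_of_le m hu], hC⟩
  · rintro ⟨u, hx, hC⟩
    exact ⟨u, u.2, by rw [toQuotPow_of_le m u.2]; exact hx, hC⟩

end Count

end UnitaryGroup

end Literature.NumberTheory.Automorphic

end
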